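import Summits.BirchSwinnertonDyer.BirchSwinnertonDyer.Theorems.SlopeDichotomyA2DegenerateLocusA2PrintPlacement
import Summits.BirchSwinnertonDyer.Rank1Residual.X1.RankOneParitySqueezeLeaf
import Literature.NumberTheory.EllipticCurves.PAdicLFunctionOrderParityProofs
import Literature.NumberTheory.EllipticCurves.CuspFormLFunctionLevelConductorProofs
import HarnessLib

/-!
# ORDER-PARITY FACE of crux `DegenerateLocusA2` (route `SlopeDichotomyA2`, rung I1-weaken, item
# stmt-BirchSwinnertonDyer-19086): on the degenerate locus of corner A2 the unit-root `p`-adic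
# `L`-function vanishes to order `≥ 3 = rank + 2` at `T = 0`, so `[T²] = 0` and `λ_an ≥ 3`; the
# PARITY-SQUEEZED Schneider certificate «`[T¹] ≠ 0 ∨ [T²] ≠ 0`»; the item ⟺ «`BSD(E,p)` where
# `ord_{T=0} L_p(E,α,T) ≥ 3`»

Support file (prover seat `bsd-schneider-i1-c2`, gen 4, cell `bsd-schneider-ideate`; `--supports
stmt-BirchSwinnertonDyer-19086`). THEOREMS ONLY over EXISTING named statements; nothing unconditional
about any curve is booked; every open input enters BY NAME as a hypothesis (`hPR` Perrin-Riou 1987 at odd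
`p`, `hGZK` Gross–Zagier–Kolyvagin, `hmod`/`hmodP` modularity, `hGV`/`hS` for the α-road only).
Companion of the gen-0/2/3 files `Theorems/SlopeDichotomyA2DegenerateLocusA2{Concrete,AnticyclotomicRoad,
Placement,PrintPlacement}.lean`. It types the planner's candidate (T4) / §1.1 Cor. 3 of memo
ROUTE-P3-v8-lambda-g10 (cell HOME, 2026-08-26) — «to be typed» there — and the Case-A half of its T-λ3.

THE ONE NEW INPUT is a TREE THEOREM: `even_order_padicLFunction_iff_even_analyticRank`
(`Literature/…/PAdicLFunctionOrderParityProofs`: `ord_{T=0} L_p(E,T) ≡ ord_{s=1} L(E,s) (mod 2)` at a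
good ordinary prime, PROVED from the Mazur–Tate–Teitelbaum functional equation of `L_p(f,α,T)`,
Atkin–Lehner, Hecke, and `L_p ≠ 0`). On corner A2 (`X1.TypeBRankOne W p`: `r_an = 1`) it makes
`ord_{T=0} L_p(f,α,T)` ODD (§1, no named fact). Gen 3 recorded `[T⁰] = 0` on A2
(`constantCoeff_padicLFunction_eq_zero_of_typeBRankOne`) and «degenerate ⟺ `[T¹] = 0`»
(`not_schneider_iff_coeff_one_eq_zero`, Perrin-Riou 1987 + GZK); hence:

* §2 `three_le_order_padicLFunction_of_degenerate`, `coeff_two_padicLFunction_eq_zero_of_degenerate`,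
  `coeff_eq_zero_of_lt_three_of_degenerate`, `rank_add_two_le_order_of_degenerate`: at a degenerate A2
  pair `ord_{T=0} L_p ≥ 3 = rank E(ℚ) + 2` — the `p`-adic BSD order defect on the locus is at least
  TWO, never one; `three_le_lam_of_degenerate` / `three_le_of_analyticLambdaEq_of_degenerate`: the
  analytic λ-invariant of ANY `Λ`-integral multiple of `L_p` is `≥ 3` there (memo T-λ3, Case A, made
  kernel-exact: the degenerate locus lies in the stratum `λ_an ≥ 3`, outside the habitat of x1b's
  halting road P₁ `RankOne.Leaf.schneider_of_analyticLambdaEq_one`).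
* §3 THE PARITY-SQUEEZED CERTIFICATE `schneider_of_coeff_two_ne_zero` (memo (T4)): at an A2 pair,
  `[T²]L_p(f,α,T) ≠ 0` for the newform of `E` ALREADY implies Schneider's non-degeneracy of THE
  canonical height — a second, independent one-coefficient shot per pair next to x1a's `[T¹] ≠ 0`
  (`X1.schneider_of_coeff_one_ne_zero_odd`); `schneider_iff_coeff_one_ne_zero_or_coeff_two_ne_zero`
  (nothing is lost); and the kernel's A2 theorem with the binder so weakened,
  `bsdp_of_typeBRankOne_of_coeff_two_ne_zero` / `…_of_coeff_one_ne_zero_or_coeff_two_ne_zero`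
  (Greenberg–Vatsal, Schneider 1985/BMS, Perrin-Riou 1987, modularity, GZK; the Mazur–Tate `σ` input
  discharged by the tree theorem `X1.PadicSigmaThree.mazur_tate_sigma_exists_odd_holds`).
* §4 `degenerateLocusA2_iff_orderThree`: item 19086 ⟺ «`BSD(E,p)` at the A2 pairs whose newform has
  `ord_{T=0} L_p(f,α,T) ≥ 3`» (mod Perrin-Riou 1987 + GZK + modularity) — gen 3's
  `degenerateLocusA2_iff_coeffOne` sharpened by one coefficient for free.

Ledger sentence (frontier ledger of rung I1): the degenerate locus of A2 — the set on which item 19086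
has content — is `{ord_T L_p(E,T) ≥ 3} ∩ A2` (mod PR87 + GZK + modularity); every pair with `[T¹] ≠ 0`
OR `[T²] ≠ 0` is off it and has `BSD(E,p)` by the α-road (mod its PUB inputs). The verdict of gens 0/2/3
(DECIDED-REDUCED: 19086 ⟺ K5 crux 5 mod Keller–Yin Thm. 3.0.8 at `𝟙` + PUB; undecidable in the tree today) stands.

References: [MazurTateTeitelbaum1986Invent] §I.17–I.18, §II.10; [PerrinRiou1987] §1.4 Cor. 1.8;
[RohrlichInventiones1984] p. 409; [GreenbergVatsal2000] Thm. (1.3); [BalakrishnanMullerStein2015] Thm. 1.7.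
-/

set_option autoImplicit false

noncomputable section

open scoped Classical MatrixGroups ModularForm

open CongruenceSubgroup WeierstrassCurve Literature.NumberTheory.EllipticCurves
  Literature.NumberTheory.EllipticCurves.ModularForms
  Literature.NumberTheory.EllipticCurves.Rank1Residual
  Summit.BirchSwinnertonDyer.Rank1Residual
  Summit.BirchSwinnertonDyer.Rank1Residual.X1.MuLambda
  Summit.BirchSwinnertonDyer.Rank1Residual.X1.ParitySqueeze
  Summit.BirchSwinnertonDyer.BirchSwinnertonDyer.Theses
  Summit.BirchSwinnertonDyer.BirchSwinnertonDyer.Theorems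
  Summit.BirchSwinnertonDyer.BirchSwinnertonDyer.Theorems.DegenerateLocusA2PrintPlacement

-- `Summit.BirchSwinnertonDyer.BirchSwinnertonDyer.…`: the summit and its single sub-problem share a name (D-0017 layout).
set_option linter.dupNamespace false

namespace Summit.BirchSwinnertonDyer.BirchSwinnertonDyer.Theorems.DegenerateLocusA2OrderParity

variable (W : WeierstrassCurve ℚ) [W.IsElliptic] [W.IsGloballyMinimal] (p : ℕ) [Fact p.Prime]

/-! ## §1. On corner A2 the order of vanishing of `L_p(f,α,T)` at `T = 0` is ODD (tree theorems only) -/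

/-- **On corner A2, `L_p(f,α,T) ≠ 0` and `ord_{T=0} L_p(f,α,T)` is odd** (for the newform `f` of `E`
at level `N_E`). `X1.TypeBRankOne W p` gives `ord_{s=1} L(E,s) = 1` and good ordinary reduction at
`p ∤ N_E` (`dvd_conductorNorm_iff_not_hasGoodReductionAtPrime`), so the tree's parity transfer
`even_order_padicLFunction_iff_even_analyticRank` (Mazur–Tate–Teitelbaum functional equation, PROVED)
makes the `T`-order odd (so `L_p ≠ 0`). No named fact. [cite: MazurTateTeitelbaum1986Invent, §I.17–I.18] -/
theorem ne_zero_and_odd_order_of_typeBRankOne (hB : X1.TypeBRankOne W p)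
    [NeZero (W.conductorNorm ℤ)] (f : CuspForm (Gamma0 (W.conductorNorm ℤ)) 2)
    (hf : IsNewformOf W f) :
    padicLFunction f (unitRoot W p : ℚ_[p]) ≠ 0 ∧
      Odd (padicLFunction f (unitRoot W p : ℚ_[p])).order.toNat := by
  have hX := isClassX1_of_classX1 hB.1
  have hord : IsOrdinaryAt W p := ⟨hX.hasGoodReductionAtPrime, hX.not_dvd_frobeniusTrace⟩
  have hpN : ¬ p ∣ W.conductorNorm ℤ := fun h ↦
    (W.dvd_conductorNorm_iff_not_hasGoodReductionAtPrime p).mp h hord.1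
  have hodd : Odd (padicLFunction f (unitRoot W p : ℚ_[p])).order.toNat := by
    rw [← Nat.not_even_iff_odd, even_order_padicLFunction_iff_even_analyticRank W p hf hpN hord,
      hB.2.1]
    exact Nat.not_even_one
  refine ⟨fun h0 ↦ ?_, hodd⟩
  rw [h0, PowerSeries.order_zero, ENat.toNat_top] at hodd
  exact absurd hodd (by decide)

/-- **On corner A2, `ord_{T=0} L_p(f,α,T) = m` for an ODD natural number `m`.** No named fact.
[cite: MazurTateTeitelbaum1986Invent, §I.17–I.18] -/
theorem exists_order_eq_odd_of_typeBRankOne (hB : X1.TypeBRankOne W p)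
    [NeZero (W.conductorNorm ℤ)] (f : CuspForm (Gamma0 (W.conductorNorm ℤ)) 2)
    (hf : IsNewformOf W f) :
    ∃ m : ℕ, (padicLFunction f (unitRoot W p : ℚ_[p])).order = m ∧ Odd m := by
  obtain ⟨hne, hodd⟩ := ne_zero_and_odd_order_of_typeBRankOne W p hB f hf
  obtain ⟨m, hm⟩ := ENat.ne_top_iff_exists.mp fun h ↦ hne (PowerSeries.order_eq_top.mp h)
  refine ⟨m, hm.symm, ?_⟩
  rwa [← hm, ENat.toNat_coe] at hodd

/-! ## §2. On the degenerate locus: `ord_{T=0} L_p ≥ 3 = rank + 2`, `[T²] = 0`, `λ_an ≥ 3` -/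

/-- **At a degenerate pair of corner A2, `ord_{T=0} L_p(f,α,T) ≥ 3`.** Granted Perrin-Riou 1987 at odd
`p` (`hPR`) and GZK (`hGZK`): `[T⁰] = 0` (`r_an = 1`,
`constantCoeff_padicLFunction_eq_zero_of_typeBRankOne`) and `[T¹] = 0` (the canonical height is
degenerate, `not_schneider_iff_coeff_one_eq_zero`) give order `≥ 2`; the order is ODD (§1), hence
`≥ 3`: order `2` is excluded by the sign of the functional equation.
[cite: MazurTateTeitelbaum1986Invent, §I.17–I.18] [cite: PerrinRiou1987, §1.4 Cor. 1.8] -/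
theorem three_le_order_padicLFunction_of_degenerate (hPR : perrinRiou_rankOne_leadingTerms_odd)
    (hGZK : rank_eq_analyticRank_of_analyticRank_le_one) (hB : X1.TypeBRankOne W p)
    (hdeg : ∃ Dh : PAdicHeightData W p, Dh.IsCanonical ∧ ¬ SchneiderConjecture Dh)
    [NeZero (W.conductorNorm ℤ)] (f : CuspForm (Gamma0 (W.conductorNorm ℤ)) 2)
    (hf : IsNewformOf W f) :
    (3 : ℕ∞) ≤ (padicLFunction f (unitRoot W p : ℚ_[p])).order := by
  obtain ⟨Dh, hDh, hnot⟩ := hdeg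
  have h0 : PowerSeries.coeff 0 (padicLFunction f (unitRoot W p : ℚ_[p])) = 0 := by
    rw [PowerSeries.coeff_zero_eq_constantCoeff_apply]
    exact constantCoeff_padicLFunction_eq_zero_of_typeBRankOne W p hB f hf
  have h1 : PowerSeries.coeff 1 (padicLFunction f (unitRoot W p : ℚ_[p])) = 0 :=
    (not_schneider_iff_coeff_one_eq_zero hPR hGZK W p hB Dh hDh f hf).mp hnot
  have h2 : ((2 : ℕ) : ℕ∞) ≤ (padicLFunction f (unitRoot W p : ℚ_[p])).order :=
    PowerSeries.nat_le_order _ 2 fun i hi ↦ by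
      interval_cases i
      · exact h0
      · exact h1
  obtain ⟨m, hm, hodd⟩ := exists_order_eq_odd_of_typeBRankOne W p hB f hf
  rw [hm] at h2 ⊢
  obtain ⟨k, rfl⟩ := hodd
  have h2' : 2 ≤ 2 * k + 1 := by exact_mod_cast h2
  exact_mod_cast (show 3 ≤ 2 * k + 1 by omega)

/-- **At a degenerate pair of corner A2, `[T²] L_p(f,α,T) = 0`** (`ord_T ≥ 3`).
[cite: MazurTateTeitelbaum1986Invent, §I.17–I.18] [cite: PerrinRiou1987, §1.4 Cor. 1.8] -/
theorem coeff_two_padicLFunction_eq_zero_of_degenerate (hPR : perrinRiou_rankOne_leadingTerms_odd)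
    (hGZK : rank_eq_analyticRank_of_analyticRank_le_one) (hB : X1.TypeBRankOne W p)
    (hdeg : ∃ Dh : PAdicHeightData W p, Dh.IsCanonical ∧ ¬ SchneiderConjecture Dh)
    [NeZero (W.conductorNorm ℤ)] (f : CuspForm (Gamma0 (W.conductorNorm ℤ)) 2)
    (hf : IsNewformOf W f) :
    PowerSeries.coeff 2 (padicLFunction f (unitRoot W p : ℚ_[p])) = 0 :=
  PowerSeries.coeff_of_lt_order 2 (lt_of_lt_of_le (by exact_mod_cast (show (2 : ℕ) < 3 by norm_num))
    (three_le_order_padicLFunction_of_degenerate W p hPR hGZK hB hdeg f hf))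

/-- **At a degenerate pair of corner A2 the first THREE coefficients of `L_p(f,α,T)` vanish.**
[cite: MazurTateTeitelbaum1986Invent, §I.17–I.18] [cite: PerrinRiou1987, §1.4 Cor. 1.8] -/
theorem coeff_eq_zero_of_lt_three_of_degenerate (hPR : perrinRiou_rankOne_leadingTerms_odd)
    (hGZK : rank_eq_analyticRank_of_analyticRank_le_one) (hB : X1.TypeBRankOne W p)
    (hdeg : ∃ Dh : PAdicHeightData W p, Dh.IsCanonical ∧ ¬ SchneiderConjecture Dh)
    [NeZero (W.conductorNorm ℤ)] (f : CuspForm (Gamma0 (W.conductorNorm ℤ)) 2)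
    (hf : IsNewformOf W f) {k : ℕ} (hk : k < 3) :
    PowerSeries.coeff k (padicLFunction f (unitRoot W p : ℚ_[p])) = 0 :=
  PowerSeries.coeff_of_lt_order k (lt_of_lt_of_le (by exact_mod_cast hk)
    (three_le_order_padicLFunction_of_degenerate W p hPR hGZK hB hdeg f hf))

/-- **`p`-adic BSD reading: on the degenerate locus `ord_{T=0} L_p(f,α,T) ≥ rank E(ℚ) + 2`** (GZK:
`rank E(ℚ) = r_an = 1`). Clause (i) of the Mazur–Tate–Teitelbaum conjecture (`PAdicBSDConjecture`,
`ord_T L_p = rank`) thus fails there by at least TWO (gen 3's `not_pAdicBSDConjecture_of_degenerate`: `≥ 1`).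
[cite: MazurTateTeitelbaum1986Invent, §II.10 Conj. BSD(p) (i)] [cite: PerrinRiou1987, §1.4 Cor. 1.8] -/
theorem rank_add_two_le_order_of_degenerate (hPR : perrinRiou_rankOne_leadingTerms_odd)
    (hGZK : rank_eq_analyticRank_of_analyticRank_le_one) (hB : X1.TypeBRankOne W p)
    (hdeg : ∃ Dh : PAdicHeightData W p, Dh.IsCanonical ∧ ¬ SchneiderConjecture Dh)
    [NeZero (W.conductorNorm ℤ)] (f : CuspForm (Gamma0 (W.conductorNorm ℤ)) 2)
    (hf : IsNewformOf W f) :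
    ((W.mordellWeilRank + 2 : ℕ) : ℕ∞) ≤ (padicLFunction f (unitRoot W p : ℚ_[p])).order := by
  have hrank : W.mordellWeilRank = 1 := (hGZK W hB.2.1.le).1.trans hB.2.1
  rw [hrank]
  exact three_le_order_padicLFunction_of_degenerate W p hPR hGZK hB hdeg f hf

/-- **λ-face (memo T-λ3, Case A, kernel-exact): on the degenerate locus `λ(g) ≥ 3` for every
`g ∈ Λ = ℤ_p⟦T⟧` and `c ∈ ℚ_pˣ` with `ι(g) = c · L_p(f,α)`** (e.g. the Néron-normalised
`ϖ · L_p(f,α) = ι(g)` of Wuthrich's Thm. 16 / `X1/MuLambda.lean`): the first three coefficients of `g`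
vanish, so `3 ≤ ord_T g ≤ λ(g)` (`RankOneParitySqueeze.order_le_lam`, Weierstrass preparation): the
degenerate locus lies in the stratum `λ_an ≥ 3`, outside the habitat of the halting road P₁ (`λ_an = 1`).
[cite: GreenbergVatsal2000, p. 2–3, (1)–(2)] [cite: Washington1997, §7.1] [cite: PerrinRiou1987, §1.4 Cor. 1.8] -/
theorem three_le_lam_of_degenerate (hPR : perrinRiou_rankOne_leadingTerms_odd)
    (hGZK : rank_eq_analyticRank_of_analyticRank_le_one) (hB : X1.TypeBRankOne W p)
    (hdeg : ∃ Dh : PAdicHeightData W p, Dh.IsCanonical ∧ ¬ SchneiderConjecture Dh)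
    [NeZero (W.conductorNorm ℤ)] (f : CuspForm (Gamma0 (W.conductorNorm ℤ)) 2)
    (hf : IsNewformOf W f) {c : ℚ_[p]} (hc : c ≠ 0) {g : IwasawaAlgebra p}
    (hg : iwasawaToPowerSeries p g = PowerSeries.C c * padicLFunction f (unitRoot W p : ℚ_[p])) :
    3 ≤ lam g := by
  have hL0 := (ne_zero_and_odd_order_of_typeBRankOne W p hB f hf).1
  have hg0 : g ≠ 0 := by
    intro h0
    rw [h0, map_zero] at hg
    have hC0 : PowerSeries.C c ≠ (0 : PowerSeries ℚ_[p]) := by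
      rw [Ne, ← map_zero (PowerSeries.C (R := ℚ_[p])), PowerSeries.C_injective.eq_iff]
      exact hc
    exact mul_ne_zero hC0 hL0 hg.symm
  have hcoeff : ∀ k < 3, PowerSeries.coeff k g = 0 := by
    intro k hk
    have e := Wuthrich2014.coeff_iwasawaToPowerSeries p g k
    rw [hg, PowerSeries.coeff_C_mul,
      coeff_eq_zero_of_lt_three_of_degenerate W p hPR hGZK hB hdeg f hf hk, mul_zero] at e
    exact PadicInt.coe_eq_zero.mp e.symm
  have h3 : ((3 : ℕ) : ℕ∞) ≤ g.order := PowerSeries.nat_le_order g 3 hcoeff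
  exact_mod_cast h3.trans (X1.RankOneParitySqueeze.order_le_lam hg0)

variable {W p} in
/-- **On the degenerate locus a certified analytic λ-invariant is at least `3`** (the typed certificate
predicate `AnalyticLambdaEq W p n` of `X1/ParitySqueeze.lean` can only hold with `n ≥ 3` there): the
data exist — modularity `hmodP` (newform `f` at level `N_E` and the rational `ϖ` with `ϖ·Ω_E = Ω⁺_f`)
and Wuthrich 2014 Thm. 16 `hW16` (`g ∈ Λ` with `ι(g) = ϖ·L_p(f,α)`) — and `λ(g) ≥ 3` by
`three_le_lam_of_degenerate`. In particular `AnalyticLambdaEq W p 1` is impossible on the locus (the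
road `RankOne.Leaf.schneider_of_analyticLambdaEq_one` read contrapositively).
[cite: Wuthrich2014, Thm. 16 (p. 393)] [cite: GreenbergVatsal2000, p. 2–3, (1)–(2)]
[cite: PerrinRiou1987, §1.4 Cor. 1.8] -/
theorem three_le_of_analyticLambdaEq_of_degenerate (hW16 : Wuthrich2014.charIdeal_dvd_padicLFunction)
    (hmodP : nonempty_modularParametrizationData) (hPR : perrinRiou_rankOne_leadingTerms_odd)
    (hGZK : rank_eq_analyticRank_of_analyticRank_le_one) (hB : X1.TypeBRankOne W p)
    (hdeg : ∃ Dh : PAdicHeightData W p, Dh.IsCanonical ∧ ¬ SchneiderConjecture Dh)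
    {n : ℕ} (hn : AnalyticLambdaEq W p n) : 3 ≤ n := by
  have hX := isClassX1_of_classX1 hB.1
  haveI : NeZero (W.conductorNorm ℤ) := ⟨(W.conductorNorm_pos_holds).ne'⟩
  obtain ⟨Dm⟩ := hmodP W
  have hf : IsNewformOf W Dm.f := Dm.isNewformOf
  obtain ⟨ϖ, hϖpos, hϖeq, -⟩ := Dm.exists_rat_mul_realPeriodRat_eq_plusPeriod
  obtain ⟨κ, hκ, γ, hγ, hγ'⟩ := exists_isCyclotomic_isTopGenerator_isCyclotomicVariable_holds p
  obtain ⟨D⟩ := W.nonempty_selmerDualData_holds κ γ hγ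
  obtain ⟨-, g, -, hιg⟩ := hW16 W p hX.two_ne ⟨hX.hasGoodReductionAtPrime, hX.not_dvd_frobeniusTrace⟩
    hX.not_hasIrreducibleModPGaloisRep hκ hγ hγ' hf D ϖ hϖeq
  rw [← hn Dm.f hf ϖ hϖeq g hιg]
  exact three_le_lam_of_degenerate W p hPR hGZK hB hdeg Dm.f hf (by exact_mod_cast hϖpos.ne') hιg

/-! ## §3. The parity-squeezed Schneider certificate «`[T¹] ≠ 0 ∨ [T²] ≠ 0`» and the α-road under it -/

/-- **THE PARITY-SQUEEZED CERTIFICATE (memo ROUTE-P3 v8 (T4)).** At a pair of corner A2, for the newform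
`f` of `E` at level `N_E`: if `[T²] L_p(f,α,T) ≠ 0` then THE canonical cyclotomic `p`-adic height is
non-degenerate (`SchneiderConjecture Dh` for every canonical datum) — granted Perrin-Riou 1987 at odd `p`
(`hPR`) and GZK (`hGZK`). Contrapositive of `coeff_two_padicLFunction_eq_zero_of_degenerate`. A second
one-coefficient certificate per pair, independent of x1a's `[T¹] ≠ 0`
(`X1.schneider_of_coeff_one_ne_zero_odd`); it can succeed only where `ord_T L_p = 1`.
[cite: PerrinRiou1987, §1.4 Cor. 1.8] [cite: MazurTateTeitelbaum1986Invent, §I.17–I.18] -/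
theorem schneider_of_coeff_two_ne_zero (hPR : perrinRiou_rankOne_leadingTerms_odd)
    (hGZK : rank_eq_analyticRank_of_analyticRank_le_one) (hB : X1.TypeBRankOne W p)
    [NeZero (W.conductorNorm ℤ)] (f : CuspForm (Gamma0 (W.conductorNorm ℤ)) 2)
    (hf : IsNewformOf W f) (h2 : PowerSeries.coeff 2 (padicLFunction f (unitRoot W p : ℚ_[p])) ≠ 0) :
    ∀ Dh : PAdicHeightData W p, Dh.IsCanonical → SchneiderConjecture Dh := by
  intro Dh hDh
  by_contra hnot
  exact h2 (coeff_two_padicLFunction_eq_zero_of_degenerate W p hPR hGZK hB ⟨Dh, hDh, hnot⟩ f hf)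

/-- **The weakened binder «`[T¹] ≠ 0 ∨ [T²] ≠ 0` ⇒ Schneider»** at a pair of corner A2 (newform at level
`N_E`; Perrin-Riou 1987 + GZK). [cite: PerrinRiou1987, §1.4 Cor. 1.8]
[cite: MazurTateTeitelbaum1986Invent, §I.17–I.18] -/
theorem schneider_of_coeff_one_ne_zero_or_coeff_two_ne_zero (hPR : perrinRiou_rankOne_leadingTerms_odd)
    (hGZK : rank_eq_analyticRank_of_analyticRank_le_one) (hB : X1.TypeBRankOne W p)
    [NeZero (W.conductorNorm ℤ)] (f : CuspForm (Gamma0 (W.conductorNorm ℤ)) 2)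
    (hf : IsNewformOf W f)
    (h12 : PowerSeries.coeff 1 (padicLFunction f (unitRoot W p : ℚ_[p])) ≠ 0 ∨
      PowerSeries.coeff 2 (padicLFunction f (unitRoot W p : ℚ_[p])) ≠ 0) :
    ∀ Dh : PAdicHeightData W p, Dh.IsCanonical → SchneiderConjecture Dh := by
  rcases h12 with h1 | h2
  · intro Dh hDh
    have hX := isClassX1_of_classX1 hB.1
    exact (Wuthrich2014.coeff_one_padicLFunction_ne_zero_iff_schneider_odd hPR hGZK W p hX.two_ne
      ⟨hX.hasGoodReductionAtPrime, hX.not_dvd_frobeniusTrace⟩ hB.2.1 Dh hDh f hf).mp h1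
  · exact schneider_of_coeff_two_ne_zero W p hPR hGZK hB f hf h2

/-- **Nothing is lost by the squeeze: at a pair of corner A2, Schneider ⟺ `[T¹] ≠ 0 ∨ [T²] ≠ 0`** (for a
canonical datum and the newform at level `N_E`; Perrin-Riou 1987 + GZK; (→) is `[T¹] ≠ 0` alone,
`Wuthrich2014.coeff_one_padicLFunction_ne_zero_iff_schneider_odd`). [cite: PerrinRiou1987, §1.4 Cor. 1.8]
[cite: MazurTateTeitelbaum1986Invent, §I.17–I.18] -/
theorem schneider_iff_coeff_one_ne_zero_or_coeff_two_ne_zero (hPR : perrinRiou_rankOne_leadingTerms_odd)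
    (hGZK : rank_eq_analyticRank_of_analyticRank_le_one) (hB : X1.TypeBRankOne W p)
    (Dh : PAdicHeightData W p) (hDh : Dh.IsCanonical)
    [NeZero (W.conductorNorm ℤ)] (f : CuspForm (Gamma0 (W.conductorNorm ℤ)) 2)
    (hf : IsNewformOf W f) :
    SchneiderConjecture Dh ↔
      (PowerSeries.coeff 1 (padicLFunction f (unitRoot W p : ℚ_[p])) ≠ 0 ∨
        PowerSeries.coeff 2 (padicLFunction f (unitRoot W p : ℚ_[p])) ≠ 0) := by
  constructor
  · intro hSch
    have hX := isClassX1_of_classX1 hB.1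
    exact Or.inl ((Wuthrich2014.coeff_one_padicLFunction_ne_zero_iff_schneider_odd hPR hGZK W p
      hX.two_ne ⟨hX.hasGoodReductionAtPrime, hX.not_dvd_frobeniusTrace⟩ hB.2.1 Dh hDh f hf).mpr hSch)
  · intro h12
    exact schneider_of_coeff_one_ne_zero_or_coeff_two_ne_zero W p hPR hGZK hB f hf h12 Dh hDh

/-- **The certificate at ANY level.** For a newform `f` of `E` at some level `N` (as x1a's certificates
are phrased), granted modularity in the form `exists_isNewformOf` (`hmod`, so `N = N_E` by strong
multiplicity one, `IsNewformOf.level_eq_conductorNorm_of_exists_isNewformOf`): `[T²] L_p(f,α,T) ≠ 0` at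
a pair of corner A2 ⇒ Schneider for every canonical datum. [cite: PerrinRiou1987, §1.4 Cor. 1.8]
[cite: AtkinLehner1970, Thm. 4] -/
theorem schneider_of_coeff_two_ne_zero_of_level (hPR : perrinRiou_rankOne_leadingTerms_odd)
    (hGZK : rank_eq_analyticRank_of_analyticRank_le_one) (hmod : exists_isNewformOf)
    (hB : X1.TypeBRankOne W p) {N : ℕ} [NeZero N] (f : CuspForm (Gamma0 N) 2) (hf : IsNewformOf W f)
    (h2 : PowerSeries.coeff 2 (padicLFunction f (unitRoot W p : ℚ_[p])) ≠ 0) :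
    ∀ Dh : PAdicHeightData W p, Dh.IsCanonical → SchneiderConjecture Dh := by
  obtain rfl : N = W.conductorNorm ℤ := IsNewformOf.level_eq_conductorNorm_of_exists_isNewformOf hmod hf
  exact schneider_of_coeff_two_ne_zero W p hPR hGZK hB f hf h2

/-- **The kernel's A2 theorem under the `[T²]`-certificate.** For `W/ℚ` globally minimal elliptic and a
prime `p` with `X1.TypeBRankOne W p`, Miller's `BSD(E,p)` follows from the PUBLISHED named facts of the
α-road — Greenberg–Vatsal 2000 Thm. (1.3) (`hGV`), Perrin-Riou–Schneider = BMS Thm. 1.7 at odd `p`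
(`hS`), Perrin-Riou 1987 at odd `p` (`hPR`), modularity (`hmodP`), GZK (`hGZK`); the Mazur–Tate `σ` at
odd `p` is the tree theorem `X1.PadicSigmaThree.mazur_tate_sigma_exists_odd_holds` — granted the finite
certificate `[T²] L_p(f,α,T) ≠ 0` for some newform `f` of `E` (at any level: `N = N_E` by strong
multiplicity one, `IsNewformOf.level_eq_level`), in place of the Schneider binder of
`X1.bsdp_of_typeBRankOne_of_schneider`. CONDITIONAL RESULT (named published facts as hypotheses); books
nothing. [cite: GreenbergVatsal2000, Thm. (1.3)] [cite: BalakrishnanMullerStein2015, Thm. 1.7]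
[cite: PerrinRiou1987, §1.4 Cor. 1.8] [cite: MazurSteinTate2006, Thm. 1.3] [cite: Miller2011LMS, Def. 1.1] -/
theorem bsdp_of_typeBRankOne_of_coeff_two_ne_zero
    (hGV : GreenbergVatsal2000.thm13_charIdeal_eq_of_gvPar)
    (hS : Schneider1985_order_charGenerator_odd) (hPR : perrinRiou_rankOne_leadingTerms_odd)
    (hmodP : nonempty_modularParametrizationData)
    (hGZK : rank_eq_analyticRank_of_analyticRank_le_one) (hB : X1.TypeBRankOne W p)
    {N : ℕ} [NeZero N] (f : CuspForm (Gamma0 N) 2) (hf : IsNewformOf W f)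
    (h2 : PowerSeries.coeff 2 (padicLFunction f (unitRoot W p : ℚ_[p])) ≠ 0) : BSDp W p := by
  haveI : NeZero (W.conductorNorm ℤ) := ⟨(W.conductorNorm_pos_holds).ne'⟩
  obtain ⟨Dm⟩ := hmodP W
  obtain rfl : N = W.conductorNorm ℤ := hf.level_eq_level Dm.isNewformOf
  exact X1.bsdp_of_typeBRankOne_of_schneider hGV hS hPR
    X1.PadicSigmaThree.mazur_tate_sigma_exists_odd_holds hmodP hGZK W p hB
    (schneider_of_coeff_two_ne_zero W p hPR hGZK hB f hf h2)

/-- **The kernel's A2 theorem under the weakened binder «`[T¹] ≠ 0 ∨ [T²] ≠ 0`»** (same inputs; the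
`[T¹]` branch is x1a's certificate road `X1.schneider_of_coeff_one_ne_zero_odd`). CONDITIONAL RESULT;
books nothing. [cite: GreenbergVatsal2000, Thm. (1.3)] [cite: BalakrishnanMullerStein2015, Thm. 1.7]
[cite: PerrinRiou1987, §1.4 Cor. 1.8] [cite: Miller2011LMS, Def. 1.1] -/
theorem bsdp_of_typeBRankOne_of_coeff_one_ne_zero_or_coeff_two_ne_zero
    (hGV : GreenbergVatsal2000.thm13_charIdeal_eq_of_gvPar)
    (hS : Schneider1985_order_charGenerator_odd) (hPR : perrinRiou_rankOne_leadingTerms_odd)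
    (hmodP : nonempty_modularParametrizationData)
    (hGZK : rank_eq_analyticRank_of_analyticRank_le_one) (hB : X1.TypeBRankOne W p)
    {N : ℕ} [NeZero N] (f : CuspForm (Gamma0 N) 2) (hf : IsNewformOf W f)
    (h12 : PowerSeries.coeff 1 (padicLFunction f (unitRoot W p : ℚ_[p])) ≠ 0 ∨
      PowerSeries.coeff 2 (padicLFunction f (unitRoot W p : ℚ_[p])) ≠ 0) : BSDp W p := by
  haveI : NeZero (W.conductorNorm ℤ) := ⟨(W.conductorNorm_pos_holds).ne'⟩
  obtain ⟨Dm⟩ := hmodP W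
  obtain rfl : N = W.conductorNorm ℤ := hf.level_eq_level Dm.isNewformOf
  exact X1.bsdp_of_typeBRankOne_of_schneider hGV hS hPR
    X1.PadicSigmaThree.mazur_tate_sigma_exists_odd_holds hmodP hGZK W p hB
    (schneider_of_coeff_one_ne_zero_or_coeff_two_ne_zero W p hPR hGZK hB f hf h12)

/-! ## §4. The item, re-read: `DegenerateLocusA2` ⟺ «`BSD(E,p)` where `ord_{T=0} L_p(f,α,T) ≥ 3`» -/

/-- **THE ORDER-THREE FACE OF THE CRUX.** Granted Perrin-Riou 1987 at odd `p` (`hPR`), GZK (`hGZK`) and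
modularity (`hmod`), the crux `SlopeDichotomyA2.DegenerateLocusA2` (item 19086) is EQUIVALENT to:
«`BSD(E,p)` at every pair of corner A2 at which every newform `f` of `E` has `ord_{T=0} L_p(f,α,T) ≥ 3`».
(→) a newform at level `N_E` exists (`hmod`); order `≥ 3` kills `[T¹]`, so THE canonical datum
(`X1.PadicSigmaThree.exists_isCanonical_odd`) is degenerate (`not_schneider_iff_coeff_one_eq_zero`) and
the crux applies; (←) at a degenerate pair every newform (level `= N_E` by `hmod`) has order `≥ 3`.
Gen 3's `degenerateLocusA2_iff_coeffOne` (order `≥ 2`) sharpened by one coefficient at no cost.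
[cite: PerrinRiou1987, §1.4 Cor. 1.8] [cite: MazurTateTeitelbaum1986Invent, §I.17–I.18, §II.10 (i)]
[cite: MazurSteinTate2006, Thm. 1.3] -/
theorem degenerateLocusA2_iff_orderThree (hPR : perrinRiou_rankOne_leadingTerms_odd)
    (hGZK : rank_eq_analyticRank_of_analyticRank_le_one) (hmod : exists_isNewformOf) :
    SlopeDichotomyA2.DegenerateLocusA2 ↔
    ∀ (W : WeierstrassCurve ℚ) [W.IsElliptic] [W.IsGloballyMinimal] (p : ℕ) [Fact p.Prime],
      X1.TypeBRankOne W p →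
      (∀ ⦃N : ℕ⦄ [NeZero N] (f : CuspForm (Gamma0 N) 2), IsNewformOf W f →
        (3 : ℕ∞) ≤ (padicLFunction f (unitRoot W p : ℚ_[p])).order) → BSDp W p := by
  constructor
  · intro hcrux W _ _ p _ hB hord3
    have hX := isClassX1_of_classX1 hB.1
    haveI : NeZero (W.conductorNorm ℤ) := ⟨(W.conductorNorm_pos_holds).ne'⟩
    obtain ⟨f, hf⟩ := hmod W
    obtain ⟨Dh, hDh⟩ := X1.PadicSigmaThree.exists_isCanonical_odd W p hX.two_ne
      hX.hasGoodReductionAtPrime hX.not_dvd_frobeniusTrace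
    have h1 : PowerSeries.coeff 1 (padicLFunction f (unitRoot W p : ℚ_[p])) = 0 :=
      PowerSeries.coeff_of_lt_order 1
        (lt_of_lt_of_le (by exact_mod_cast (show (1 : ℕ) < 3 by norm_num)) (hord3 f hf))
    exact hcrux W p hB ⟨Dh, hDh, (not_schneider_iff_coeff_one_eq_zero hPR hGZK W p hB Dh hDh f hf).mpr h1⟩
  · intro h W _ _ p _ hB hdeg
    refine h W p hB fun N _ f hf ↦ ?_
    obtain rfl : N = W.conductorNorm ℤ :=
      IsNewformOf.level_eq_conductorNorm_of_exists_isNewformOf hmod hf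
    exact three_le_order_padicLFunction_of_degenerate W p hPR hGZK hB hdeg f hf

/-- **Item 19086 ⟸ «`BSD(E,p)` on `{ord_T L_p ≥ 3} ∩ A2`»** (the usable direction, by name).
[cite: PerrinRiou1987, §1.4 Cor. 1.8] [cite: MazurTateTeitelbaum1986Invent, §I.17–I.18] -/
theorem degenerateLocusA2_of_bsdp_on_orderThree (hPR : perrinRiou_rankOne_leadingTerms_odd)
    (hGZK : rank_eq_analyticRank_of_analyticRank_le_one) (hmod : exists_isNewformOf)
    (h : ∀ (W : WeierstrassCurve ℚ) [W.IsElliptic] [W.IsGloballyMinimal] (p : ℕ) [Fact p.Prime],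
      X1.TypeBRankOne W p →
      (∀ ⦃N : ℕ⦄ [NeZero N] (f : CuspForm (Gamma0 N) 2), IsNewformOf W f →
        (3 : ℕ∞) ≤ (padicLFunction f (unitRoot W p : ℚ_[p])).order) → BSDp W p) :
    SlopeDichotomyA2.DegenerateLocusA2 :=
  (degenerateLocusA2_iff_orderThree hPR hGZK hmod).mpr h

end Summit.BirchSwinnertonDyer.BirchSwinnertonDyer.Theorems.DegenerateLocusA2OrderParity

end
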